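import Literature.Topology.FourManifolds.RegularDomainExtension
import Literature.Topology.FourManifolds.HandlebodyClassificationProofs
import Mathlib.Analysis.Calculus.LocalExtr.Basic
import Mathlib.Geometry.Manifold.LocalDiffeomorph
import HarnessLib

/-!
# Comparing two functions along a common level: the comparison function of a diffeomorphism of
# sublevel sets and its normal derivative

Topic `Literature/Topology/FourManifolds` (fact seat
`provefact-Literature.Topology.FourManifolds.IsHandlebody.exists_diffeomorph_isBoundaryGluing_sphere`,
step F2b₁ of the Lickorish–Wallace DAG; second layer of the *level normalisation* feeding the
uniqueness of attaching one `1`-handle, L1 `oneHandle_nonempty_diffeomorph`, into the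
level-compatible handle-extension machinery `HandleStepAssembly.lean`).  Everything here is
**proved**; no named facts.

Let `f : M → ℝ`, `f' : M' → ℝ` be smooth functions on manifolds with boundary and `a`, `a'`
regular levels with the sublevel sets `N = {f ≤ a}`, `N' = {f' ≤ a'}` in the interior
(structures `sublevelAtlas`, `RegularSublevelSet.lean`), and let `Ψ₀ : N ≅ N'` be **any**
diffeomorphism.  The *comparison function* is a smooth `G : M → ℝ` with `G = f' ∘ Ψ₀` on `N`
(it exists by Seeley's theorem, `RegularDomainExtension.lean`; packaged with the rest of the
data as `Literature.Topology.FourManifolds.LevelComparison`, `LevelComparison.exists`).  Since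
`Ψ₀` carries the boundary `{f = a}` of `N` onto the boundary `{f' = a'}` of `N'`, `G = a'` on the
level `{f = a}` and `G < a'` on `{f < a}` (`G_eq_of_eq`, `G_lt_of_lt`).  The main result is the
first-order behaviour of `G` across the level, read in the straightening half-slice chart `Θ`
of `N` at a level point `p` (in which `a - f` is the `0`-th coordinate,
`sublevelAtlas_datum_apply_zero_of_eq`):

* `fderiv_comp_symm_eq_smul` — **`d(G ∘ Θ⁻¹)(Θ p) = c · dz₀` with `c < 0`**, i.e. on the level
  `dG = λ df` with `λ = -c·(-1)⁻¹… > 0`: the tangential derivatives vanish because `G` is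
  constant on the level, `c ≤ 0` because `G ≤ a' = G p` on the side `z₀ ≥ 0` (one-sided
  maximum, `IsLocalMaxOn.hasFDerivWithinAt_nonpos`), and `c ≠ 0` because
  `d(f'|_{N'}) ≠ 0` at the regular level `a'` while `dΨ₀` is onto
  (`Diffeomorph.mfderivToContinuousLinearEquiv`, `HalfSliceAtlas.mfderiv_comp_val_eq`);
* `exists_ball_bounds` — **uniform local bounds**: a ball `B` about `Θ p` inside `Θ.target`,
  `λ > 0` and `C ≥ 0` with `∂₀(G ∘ Θ⁻¹) ≤ -λ` on `B` and the Hadamard bound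
  `|G ∘ Θ⁻¹ - a' + z₀| ≤ C z₀` on `B ∩ {z₀ ≥ 0}` (mean value theorem along the normal segment,
  `Convex.norm_image_sub_le_of_norm_fderiv_le`).

These are the two estimates under which `f` and `G + (a - a')` can be spliced across a thin
collar below the level without creating critical points (sequel `LevelSplicing.lean`), which
turns `Ψ₀` into a level-preserving diffeomorphism of smaller sublevel sets — the normalisation
"we may assume the diffeomorphism preserves the levels near the boundary" of Milnor's proof of
Thm. 3.13 (*Lectures on the h-cobordism theorem* (1965), PDF pp. 18–19, via the collar/product
neighbourhood of Thm. 3.4) and of Kosinski, *Differential Manifolds* (1993), VI §7, VII §2,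
here obtained by modifying the *function* rather than the map (no uniqueness of collars is
used).

## References

* J. Milnor, *Lectures on the h-cobordism theorem* (1965), Lemma 2.9, Thm. 3.4, proof of
  Thm. 3.13. [MilnorHCobordism1965]
* A. A. Kosinski, *Differential Manifolds* (1993), VI §7, VII §2. [Kosinski1993]
* J. M. Lee, *Introduction to Smooth Manifolds*, 2nd ed. (2013), Lemma 2.26, Thm. 5.48.
  [LeeSmoothManifolds2013]
-/

open scoped Manifold ContDiff Topology
open Set Function Filter Metric

noncomputable section

namespace Literature.Topology.FourManifolds

universe u

/-- Local notation: `𝔼 n` is the model Euclidean space `EuclideanSpace ℝ (Fin n)`. -/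
local notation "𝔼 " n:arg => EuclideanSpace ℝ (Fin n)
/-- Local notation: `ℍ n` is the model half-space `EuclideanHalfSpace n`. -/
local notation "ℍ " n:arg => EuclideanHalfSpace n

variable (k : ℕ) (M : Type u) [TopologicalSpace M] [ChartedSpace (ℍ (k + 1)) M] [IsManifold (𝓡∂ (k + 1)) ∞ M]
  (M' : Type u) [TopologicalSpace M'] [ChartedSpace (ℍ (k + 1)) M'] [IsManifold (𝓡∂ (k + 1)) ∞ M']

/-- **Comparison data of a diffeomorphism of regular sublevel sets.**  Smooth functions `f`, `f'`
on two manifolds with boundary, regular levels `a`, `a'` with the sublevel sets in the interior,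
a diffeomorphism `Ψ₀ : {f ≤ a} ≅ {f' ≤ a'}` of the sublevel sets with their structures
`sublevelAtlas` (Milnor 1965, Lemma 2.9), and a smooth *comparison function* `G : M → ℝ`
extending `f' ∘ Ψ₀` (Seeley; `LevelComparison.exists`). [cite: MilnorHCobordism1965, Lemma 2.9 and proof of Thm. 3.13] -/
structure LevelComparison where
  /-- The function on `M`. -/
  f : M → ℝ
  /-- The level. -/
  a : ℝ
  hf : ContMDiff (𝓡∂ (k + 1)) 𝓘(ℝ, ℝ) ∞ f
  hint : ∀ p, f p ≤ a → (𝓡∂ (k + 1)).IsInteriorPoint p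
  hreg : ∀ p, f p = a → ¬ IsMCriticalPt (𝓡∂ (k + 1)) f p
  /-- The function on `M'`. -/
  f' : M' → ℝ
  /-- The level on `M'`. -/
  a' : ℝ
  hf' : ContMDiff (𝓡∂ (k + 1)) 𝓘(ℝ, ℝ) ∞ f'
  hint' : ∀ p, f' p ≤ a' → (𝓡∂ (k + 1)).IsInteriorPoint p
  hreg' : ∀ p, f' p = a' → ¬ IsMCriticalPt (𝓡∂ (k + 1)) f' p
  /-- The diffeomorphism of the sublevel sets. -/
  Ψ₀ : letI := (sublevelAtlas hf a hint hreg).chartedSpace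
    letI := (sublevelAtlas hf' a' hint' hreg').chartedSpace
    ↥(f ⁻¹' Iic a) ≃ₘ⟮𝓡∂ (k + 1), 𝓡∂ (k + 1)⟯ ↥(f' ⁻¹' Iic a')
  /-- The comparison function. -/
  G : M → ℝ
  hG : ContMDiff (𝓡∂ (k + 1)) 𝓘(ℝ, ℝ) ∞ G
  G_coe : ∀ x : ↥(f ⁻¹' Iic a), G x = f' (Ψ₀ x)

namespace LevelComparison

variable {k M M'} (c : LevelComparison k M M')

/-- The half-slice atlas of `{f ≤ a}`. [folklore] -/
abbrev atlas : HalfSliceAtlas (𝓡∂ (k + 1)) (c.f ⁻¹' Iic c.a) := sublevelAtlas c.hf c.a c.hint c.hreg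

/-- The half-slice atlas of `{f' ≤ a'}`. [folklore] -/
abbrev atlas' : HalfSliceAtlas (𝓡∂ (k + 1)) (c.f' ⁻¹' Iic c.a') := sublevelAtlas c.hf' c.a' c.hint' c.hreg'

/-- **Existence of the comparison data**: any diffeomorphism of regular sublevel sets (with `M`
σ-compact Hausdorff) has a comparison function, by the extension of smooth functions from the
closed regular domain `{f ≤ a}` (`exists_contMDiff_forall_eq_sublevel`, Seeley).
[cite: LeeSmoothManifolds2013, Lemma 2.26] -/
theorem «exists» [T2Space M] [SigmaCompactSpace M] {f : M → ℝ} (hf : ContMDiff (𝓡∂ (k + 1)) 𝓘(ℝ, ℝ) ∞ f)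
    {a : ℝ} (hint : ∀ p, f p ≤ a → (𝓡∂ (k + 1)).IsInteriorPoint p)
    (hreg : ∀ p, f p = a → ¬ IsMCriticalPt (𝓡∂ (k + 1)) f p)
    {f' : M' → ℝ} (hf' : ContMDiff (𝓡∂ (k + 1)) 𝓘(ℝ, ℝ) ∞ f')
    {a' : ℝ} (hint' : ∀ p, f' p ≤ a' → (𝓡∂ (k + 1)).IsInteriorPoint p)
    (hreg' : ∀ p, f' p = a' → ¬ IsMCriticalPt (𝓡∂ (k + 1)) f' p)
    (Ψ₀ : letI := (sublevelAtlas hf a hint hreg).chartedSpace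
      letI := (sublevelAtlas hf' a' hint' hreg').chartedSpace
      ↥(f ⁻¹' Iic a) ≃ₘ⟮𝓡∂ (k + 1), 𝓡∂ (k + 1)⟯ ↥(f' ⁻¹' Iic a')) :
    ∃ c : LevelComparison k M M', c.f = f ∧ c.a = a ∧ c.f' = f' ∧ c.a' = a' ∧ c.Ψ₀ ≍ Ψ₀ := by
  letI := (sublevelAtlas hf a hint hreg).chartedSpace
  letI := (sublevelAtlas hf' a' hint' hreg').chartedSpace
  haveI := (sublevelAtlas hf a hint hreg).isManifold
  haveI := (sublevelAtlas hf' a' hint' hreg').isManifold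
  have hg : ContMDiff (𝓡∂ (k + 1)) 𝓘(ℝ, ℝ) ∞ fun x : ↥(f ⁻¹' Iic a) => f' ((Ψ₀ x : ↥(f' ⁻¹' Iic a')) : M') :=
    hf'.comp ((sublevelAtlas hf' a' hint' hreg').contMDiff_subtype_val_of_halfSlice.comp Ψ₀.contMDiff)
  obtain ⟨G, hG, hGeq⟩ := exists_contMDiff_forall_eq_sublevel hf hint hreg hg
  exact ⟨⟨f, a, hf, hint, hreg, f', a', hf', hint', hreg', Ψ₀, G, hG, hGeq⟩, rfl, rfl, rfl, rfl, HEq.rfl⟩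

/-! ### Values of the comparison function -/

/-- `G ≤ a'` on `{f ≤ a}`. [folklore] -/
theorem G_le (x : M) (hx : c.f x ≤ c.a) : c.G x ≤ c.a' := by
  rw [c.G_coe ⟨x, hx⟩]
  exact (c.Ψ₀ ⟨x, hx⟩).2

/-- `Ψ₀` carries the level `{f = a}` onto the level `{f' = a'}` (boundary to boundary).
[cite: Milnor1963, Thm. 3.1] -/
theorem apply_Ψ₀_eq_iff (x : ↥(c.f ⁻¹' Iic c.a)) : c.f' (c.Ψ₀ x) = c.a' ↔ c.f x = c.a := by
  letI := c.atlas.chartedSpace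
  letI := c.atlas'.chartedSpace
  haveI := c.atlas.isManifold
  haveI := c.atlas'.isManifold
  have hpre : c.Ψ₀ ⁻¹' (𝓡∂ (k + 1)).boundary ↥(c.f' ⁻¹' Iic c.a') = (𝓡∂ (k + 1)).boundary ↥(c.f ⁻¹' Iic c.a) :=
    c.Ψ₀.preimage_boundary (by simp)
  rw [← isBoundaryPoint_sublevel_iff c.hf' c.a' c.hint' c.hreg' (c.Ψ₀ x),
    ← isBoundaryPoint_sublevel_iff c.hf c.a c.hint c.hreg x]
  change c.Ψ₀ x ∈ (𝓡∂ (k + 1)).boundary ↥(c.f' ⁻¹' Iic c.a') ↔ x ∈ (𝓡∂ (k + 1)).boundary ↥(c.f ⁻¹' Iic c.a)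
  rw [← hpre, mem_preimage]

/-- `G = a'` on the level `{f = a}`. [folklore] -/
theorem G_eq_of_eq (x : M) (hx : c.f x = c.a) : c.G x = c.a' := by
  rw [c.G_coe ⟨x, hx.le⟩]
  exact (c.apply_Ψ₀_eq_iff ⟨x, hx.le⟩).2 hx

/-- `G < a'` on `{f < a}`. [folklore] -/
theorem G_lt_of_lt (x : M) (hx : c.f x < c.a) : c.G x < c.a' := by
  rw [c.G_coe ⟨x, hx.le⟩]
  refine lt_of_le_of_ne (c.Ψ₀ ⟨x, hx.le⟩).2 fun h => ?_
  exact hx.ne ((c.apply_Ψ₀_eq_iff ⟨x, hx.le⟩).1 h)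

/-! ### The straightening chart at a level point -/

/-- The half-slice chart of `{f ≤ a}` at a point `p` with `f p ≤ a`. [folklore] -/
abbrev chart (p : M) (hp : c.f p ≤ c.a) : OpenPartialHomeomorph M (𝔼 (k + 1)) :=
  (c.atlas.datum ⟨p, hp⟩).Θ

/-- `p` lies in the source of its chart. [folklore] -/
theorem mem_chart_source (p : M) (hp : c.f p ≤ c.a) : p ∈ (c.chart p hp).source :=
  c.atlas.mem_source ⟨p, hp⟩

/-- In the chart at a level point, the `0`-th coordinate is `a - f`. [cite: MilnorHCobordism1965, Lemma 2.9] -/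
theorem chart_apply_zero (p : M) (hp : c.f p = c.a) {q : M} (hq : q ∈ (c.chart p hp.le).source) :
    c.chart p hp.le q 0 = c.a - c.f q :=
  sublevelAtlas_datum_apply_zero_of_eq c.hf c.a c.hint c.hreg ⟨p, hp.le⟩ hp hq

/-- `f ∘ Θ⁻¹ = a - z₀` on the target of the chart at a level point. [folklore] -/
theorem f_chart_symm (p : M) (hp : c.f p = c.a) {z : 𝔼 (k + 1)} (hz : z ∈ (c.chart p hp.le).target) :
    c.f ((c.chart p hp.le).symm z) = c.a - z 0 := by
  have h := c.chart_apply_zero p hp ((c.chart p hp.le).map_target hz)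
  rw [(c.chart p hp.le).right_inv hz] at h
  linarith

/-- The chart of a level point sends it to the hyperplane `{z₀ = 0}`. [folklore] -/
theorem chart_self_zero (p : M) (hp : c.f p = c.a) : c.chart p hp.le p 0 = 0 := by
  rw [c.chart_apply_zero p hp (c.mem_chart_source p hp.le), hp, sub_self]

/-- `G ∘ Θ⁻¹ = a'` on the hyperplane part of the target. [folklore] -/
theorem G_chart_symm_of_zero (p : M) (hp : c.f p = c.a) {z : 𝔼 (k + 1)} (hz : z ∈ (c.chart p hp.le).target)
    (hz0 : z 0 = 0) : c.G ((c.chart p hp.le).symm z) = c.a' :=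
  c.G_eq_of_eq _ (by rw [c.f_chart_symm p hp hz, hz0, sub_zero])

/-- `G ∘ Θ⁻¹ ≤ a'` on the half `{z₀ ≥ 0}` of the target. [folklore] -/
theorem G_chart_symm_le (p : M) (hp : c.f p = c.a) {z : 𝔼 (k + 1)} (hz : z ∈ (c.chart p hp.le).target)
    (hz0 : 0 ≤ z 0) : c.G ((c.chart p hp.le).symm z) ≤ c.a' :=
  c.G_le _ (by rw [c.f_chart_symm p hp hz]; linarith)

/-- `G ∘ Θ⁻¹` is smooth on the target. [folklore] -/
theorem contDiffOn_G_chart_symm (p : M) (hp : c.f p ≤ c.a) :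
    ContDiffOn ℝ ∞ (c.G ∘ (c.chart p hp).symm) (c.chart p hp).target :=
  contMDiffOn_iff_contDiffOn.1 (c.hG.comp_contMDiffOn (c.atlas.datum ⟨p, hp⟩).contMDiffOn_symm)

/-- `G ∘ Θ⁻¹` is `C^∞` at points of the target. [folklore] -/
theorem contDiffAt_G_chart_symm (p : M) (hp : c.f p ≤ c.a) {z : 𝔼 (k + 1)} (hz : z ∈ (c.chart p hp).target) :
    ContDiffAt ℝ ∞ (c.G ∘ (c.chart p hp).symm) z :=
  (c.contDiffOn_G_chart_symm p hp).contDiffAt ((c.chart p hp).open_target.mem_nhds hz)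

/-! ### The derivative of the comparison function at a level point -/

section Deriv

variable (p : M) (hp : c.f p = c.a)

/-- The unit normal coordinate vector `e₀` of `ℝᵏ⁺¹`. [folklore] -/
abbrev e₀ : 𝔼 (k + 1) := EuclideanSpace.single (0 : Fin (k + 1)) (1 : ℝ)

omit [IsManifold (𝓡∂ (k + 1)) ∞ M] [IsManifold (𝓡∂ (k + 1)) ∞ M'] in
/-- `e₀ 0 = 1`. [folklore] -/
@[simp] theorem e₀_apply_zero : (e₀ : 𝔼 (k + 1)) 0 = 1 := by
  simp

/-- `G ∘ Θ⁻¹` is differentiable at the image of the level point. [folklore] -/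
theorem hasFDerivAt_G_chart_symm {z : 𝔼 (k + 1)} (hz : z ∈ (c.chart p hp.le).target) :
    HasFDerivAt (c.G ∘ (c.chart p hp.le).symm) (fderiv ℝ (c.G ∘ (c.chart p hp.le).symm) z) z :=
  ((c.contDiffAt_G_chart_symm p hp.le hz).differentiableAt (by simp)).hasFDerivAt

/-- **Tangential derivatives of the comparison function vanish on the level**: for `w` with
`w 0 = 0`, `d(G ∘ Θ⁻¹)(Θ p) w = 0`, because `G ∘ Θ⁻¹` is constant (`= a'`) on the hyperplane
`{z₀ = 0}`, the image of the level. [folklore] -/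
theorem fderiv_G_chart_symm_apply_eq_zero {w : 𝔼 (k + 1)} (hw : w 0 = 0) :
    fderiv ℝ (c.G ∘ (c.chart p hp.le).symm) (c.chart p hp.le p) w = 0 := by
  set Θ := c.chart p hp.le with hΘ
  set z₀ := Θ p with hz₀
  have hz₀t : z₀ ∈ Θ.target := Θ.map_source (c.mem_chart_source p hp.le)
  -- the line `s ↦ z₀ + s • w` in the hyperplane
  set ℓ : ℝ → 𝔼 (k + 1) := fun s => z₀ + s • w with hℓ
  have hℓ0 : ℓ 0 = z₀ := by simp [hℓ]
  have hℓd : HasDerivAt ℓ w 0 := by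
    have := ((hasDerivAt_id (0 : ℝ)).smul_const w).const_add z₀
    simpa [hℓ] using this
  have h1 : HasDerivAt ((c.G ∘ Θ.symm) ∘ ℓ) (fderiv ℝ (c.G ∘ Θ.symm) (ℓ 0) w) 0 :=
    (c.hasFDerivAt_G_chart_symm p hp (hℓ0 ▸ hz₀t)).comp_hasDerivAt 0 hℓd
  rw [hℓ0] at h1
  -- the composite is eventually constant
  have hev : ∀ᶠ s in 𝓝 (0 : ℝ), ((c.G ∘ Θ.symm) ∘ ℓ) s = c.a' := by
    have hcont : Continuous ℓ := by fun_prop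
    have hmem : ∀ᶠ s in 𝓝 (0 : ℝ), ℓ s ∈ Θ.target := by
      refine hcont.continuousAt.preimage_mem_nhds ?_
      rw [hℓ0]; exact Θ.open_target.mem_nhds hz₀t
    filter_upwards [hmem] with s hs
    refine c.G_chart_symm_of_zero p hp hs ?_
    show (z₀ + s • w) 0 = 0
    rw [PiLp.add_apply, PiLp.smul_apply, hw, smul_zero, add_zero, hz₀, c.chart_self_zero p hp]
  have h2 : HasDerivAt ((c.G ∘ Θ.symm) ∘ ℓ) 0 0 :=
    (hasDerivAt_const (0 : ℝ) c.a').congr_of_eventuallyEq hev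
  exact h1.unique h2

/-- **`d(G ∘ Θ⁻¹)(Θ p)` is a multiple of `dz₀`.** [folklore] -/
theorem fderiv_G_chart_symm_eq_smul :
    fderiv ℝ (c.G ∘ (c.chart p hp.le).symm) (c.chart p hp.le p) =
      (fderiv ℝ (c.G ∘ (c.chart p hp.le).symm) (c.chart p hp.le p) e₀) • EuclideanSpace.proj (0 : Fin (k + 1)) := by
  ext w
  set L := fderiv ℝ (c.G ∘ (c.chart p hp.le).symm) (c.chart p hp.le p) with hL
  have hdec : w = (w 0) • (e₀ : 𝔼 (k + 1)) + (w - (w 0) • e₀) := by abel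
  have htan : (w - (w 0) • (e₀ : 𝔼 (k + 1))) 0 = 0 := by
    rw [PiLp.sub_apply, PiLp.smul_apply, e₀_apply_zero, smul_eq_mul, mul_one, sub_self]
  conv_lhs => rw [hdec, map_add, map_smul, c.fderiv_G_chart_symm_apply_eq_zero p hp htan, add_zero]
  simp [mul_comm]

/-- **The normal derivative of the comparison function is `≤ 0` in the depth direction**:
`d(G ∘ Θ⁻¹)(Θ p) e₀ ≤ 0`, since `G ∘ Θ⁻¹ ≤ a' = G p` on the side `{z₀ ≥ 0}` (one-sided maximum).
[folklore] -/
theorem fderiv_G_chart_symm_e₀_nonpos :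
    fderiv ℝ (c.G ∘ (c.chart p hp.le).symm) (c.chart p hp.le p) e₀ ≤ 0 := by
  set Θ := c.chart p hp.le with hΘ
  set z₀ := Θ p with hz₀
  have hz₀t : z₀ ∈ Θ.target := Θ.map_source (c.mem_chart_source p hp.le)
  have hz₀0 : z₀ 0 = 0 := c.chart_self_zero p hp
  set s : Set (𝔼 (k + 1)) := {z | 0 ≤ z 0} with hs
  have hmax : IsLocalMaxOn (c.G ∘ Θ.symm) s z₀ := by
    have hval : (c.G ∘ Θ.symm) z₀ = c.a' := by
      show c.G (Θ.symm (Θ p)) = c.a'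
      rw [Θ.left_inv (c.mem_chart_source p hp.le)]; exact c.G_eq_of_eq p hp
    have hmem : ∀ᶠ z in 𝓝 z₀, z ∈ Θ.target := Θ.open_target.mem_nhds hz₀t
    rw [IsLocalMaxOn, IsMaxFilter, eventually_nhdsWithin_iff]
    filter_upwards [hmem] with z hz hzs
    rw [hval]
    exact c.G_chart_symm_le p hp hz hzs
  have hseg : segment ℝ z₀ (z₀ + e₀) ⊆ s := by
    rw [segment_subset_iff]
    intro u v hu hv huv
    show 0 ≤ (u • z₀ + v • (z₀ + e₀) : 𝔼 (k + 1)) 0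
    simp only [PiLp.add_apply, PiLp.smul_apply, smul_eq_mul, hz₀0, e₀_apply_zero]
    nlinarith
  exact hmax.hasFDerivWithinAt_nonpos (c.hasFDerivAt_G_chart_symm p hp hz₀t).hasFDerivWithinAt
    (mem_posTangentConeAt_of_segment_subset hseg)

/-- **The derivative of the comparison function does not vanish on the level**:
`d(G ∘ Θ⁻¹)(Θ p) ≠ 0`.  Indeed `d(G|_N)_p = d(f'|_{N'})_{Ψ₀ p} ∘ dΨ₀|_p` with `dΨ₀|_p` onto
(`Diffeomorph.mfderivToContinuousLinearEquiv`) and `d(f'|_{N'}) ≠ 0` at the regular level `a'`;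
the manifold derivatives of the restrictions are read in the half-slice charts by
`HalfSliceAtlas.mfderiv_comp_val_eq`. [cite: MilnorHCobordism1965, Lemma 2.9] -/
theorem fderiv_G_chart_symm_ne_zero :
    fderiv ℝ (c.G ∘ (c.chart p hp.le).symm) (c.chart p hp.le p) ≠ 0 := by
  letI := c.atlas.chartedSpace
  letI := c.atlas'.chartedSpace
  haveI := c.atlas.isManifold
  haveI := c.atlas'.isManifold
  set P : ↥(c.f ⁻¹' Iic c.a) := ⟨p, hp.le⟩ with hP
  set P' : ↥(c.f' ⁻¹' Iic c.a') := c.Ψ₀ P with hP'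
  have hval : ContMDiff (𝓡∂ (k + 1)) (𝓡∂ (k + 1)) ∞ (Subtype.val : ↥(c.f ⁻¹' Iic c.a) → M) :=
    c.atlas.contMDiff_subtype_val_of_halfSlice
  have hval' : ContMDiff (𝓡∂ (k + 1)) (𝓡∂ (k + 1)) ∞ (Subtype.val : ↥(c.f' ⁻¹' Iic c.a') → M') :=
    c.atlas'.contMDiff_subtype_val_of_halfSlice
  -- `d(G|_N)_P` read in the chart
  have hGS : MDifferentiableAt (𝓡∂ (k + 1)) 𝓘(ℝ, ℝ) (c.G ∘ Subtype.val) P :=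
    ((c.hG.comp hval) P).mdifferentiableAt (by simp)
  have hread : mfderiv (𝓡∂ (k + 1)) 𝓘(ℝ, ℝ) (c.G ∘ Subtype.val) P =
      fderiv ℝ (c.G ∘ (c.chart p hp.le).symm) (c.chart p hp.le p) :=
    c.atlas.mfderiv_comp_val_eq c.G P hGS
      ((c.contDiffAt_G_chart_symm p hp.le ((c.chart p hp.le).map_source (c.mem_chart_source p hp.le))).differentiableAt
        (by simp))
  -- `G|_N = f'|_{N'} ∘ Ψ₀`
  have hfun : (c.G ∘ Subtype.val : ↥(c.f ⁻¹' Iic c.a) → ℝ) = (c.f' ∘ Subtype.val) ∘ c.Ψ₀ := by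
    funext x; exact c.G_coe x
  have hg' : MDifferentiableAt (𝓡∂ (k + 1)) 𝓘(ℝ, ℝ) (c.f' ∘ Subtype.val) P' :=
    ((c.hf'.comp hval') P').mdifferentiableAt (by simp)
  have hΨ : MDifferentiableAt (𝓡∂ (k + 1)) (𝓡∂ (k + 1)) c.Ψ₀ P := c.Ψ₀.mdifferentiable (by simp) P
  have hcomp : mfderiv (𝓡∂ (k + 1)) 𝓘(ℝ, ℝ) (c.G ∘ Subtype.val) P =
      (mfderiv (𝓡∂ (k + 1)) 𝓘(ℝ, ℝ) (c.f' ∘ Subtype.val) P').comp (mfderiv (𝓡∂ (k + 1)) (𝓡∂ (k + 1)) c.Ψ₀ P) := by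
    rw [hfun]; exact mfderiv_comp P hg' hΨ
  -- `d(f'|_{N'})_{P'} ≠ 0` at the regular level
  have hP'a : c.f' P' = c.a' := (c.apply_Ψ₀_eq_iff P).2 hp
  have hne' : mfderiv (𝓡∂ (k + 1)) 𝓘(ℝ, ℝ) (c.f' ∘ Subtype.val) P' ≠ 0 := by
    set D' := c.atlas'.datum P' with hD'
    have hsrc : P'.1 ∈ D'.Θ.source := c.atlas'.mem_source P'
    have hdiff : DifferentiableAt ℝ (c.f' ∘ D'.Θ.symm) (D'.Θ P'.1) := by
      have h1 : ContMDiffOn 𝓘(ℝ, 𝔼 (k + 1)) 𝓘(ℝ, ℝ) ∞ (c.f' ∘ D'.Θ.symm) D'.Θ.target :=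
        c.hf'.comp_contMDiffOn D'.contMDiffOn_symm
      exact ((contMDiffOn_iff_contDiffOn.1 h1).contDiffAt
        (D'.Θ.open_target.mem_nhds (D'.Θ.map_source hsrc))).differentiableAt (by simp)
    rw [c.atlas'.mfderiv_comp_val_eq c.f' P' hg' hdiff]
    intro h0
    exact c.hreg' P'.1 hP'a ((isMCriticalPt_iff_fderiv_comp_symm_eq_zero D'.contMDiffOn_toFun
      D'.contMDiffOn_symm hsrc ((c.hf' P'.1).mdifferentiableAt (by simp))).2 h0)
  -- `dΨ₀|_P` is onto
  have hn : (∞ : ℕ∞ω) ≠ 0 := by simp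
  have hsurj : Surjective (mfderiv (𝓡∂ (k + 1)) (𝓡∂ (k + 1)) c.Ψ₀ P) := by
    rw [← Diffeomorph.mfderivToContinuousLinearEquiv_coe c.Ψ₀ hn]
    exact (c.Ψ₀.mfderivToContinuousLinearEquiv hn P).surjective
  -- conclusion
  intro h0
  apply hne'
  have hzero : (mfderiv (𝓡∂ (k + 1)) 𝓘(ℝ, ℝ) (c.f' ∘ Subtype.val) P').comp
      (mfderiv (𝓡∂ (k + 1)) (𝓡∂ (k + 1)) c.Ψ₀ P) = 0 := by
    rw [← hcomp, hread, h0]; rfl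
  ext v
  obtain ⟨u, rfl⟩ := hsurj v
  exact ContinuousLinearMap.ext_iff.1 hzero u

/-- **First-order behaviour of the comparison function across the level.**  At a level point
`p`, in the straightening chart `Θ` (`z₀ = a - f`): `d(G ∘ Θ⁻¹)(Θ p) = -λ · dz₀` with `λ > 0`.
Equivalently `dG_p = λ df_p`, `λ > 0`: the two functions `f` and `G` (`= f' ∘ Ψ₀` on `{f ≤ a}`)
cross their common level in the same direction at comparable speeds. [cite: MilnorHCobordism1965, proof of Thm. 3.13] -/
theorem exists_fderiv_G_chart_symm_eq :
    ∃ lam : ℝ, 0 < lam ∧ fderiv ℝ (c.G ∘ (c.chart p hp.le).symm) (c.chart p hp.le p) =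
      (-lam) • EuclideanSpace.proj (0 : Fin (k + 1)) := by
  set c₀ := fderiv ℝ (c.G ∘ (c.chart p hp.le).symm) (c.chart p hp.le p) e₀ with hc₀
  have hle : c₀ ≤ 0 := c.fderiv_G_chart_symm_e₀_nonpos p hp
  have hne : c₀ ≠ 0 := by
    intro h0
    apply c.fderiv_G_chart_symm_ne_zero p hp
    rw [c.fderiv_G_chart_symm_eq_smul p hp, ← hc₀, h0, zero_smul]
  have hlt : c₀ < 0 := lt_of_le_of_ne hle hne
  refine ⟨-c₀, by linarith, ?_⟩
  rw [neg_neg]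
  exact c.fderiv_G_chart_symm_eq_smul p hp

/-- **Uniform local bounds near a level point.**  In the chart `Θ` at the level point `p`
there are a radius `r > 0` with `B̄(Θ p, r) ⊆ Θ.target`, a constant `λ > 0` with
`∂₀(G ∘ Θ⁻¹) ≤ -λ` on the ball `B(Θ p, r)` (continuity of the derivative), and a constant
`C ≥ 0` with the **Hadamard bound** `|G ∘ Θ⁻¹(z) - a' + z₀| ≤ C z₀` for `z` in the ball with
`z₀ ≥ 0` (mean value theorem along the normal segment from the hyperplane point
`z - z₀ e₀`, where `G ∘ Θ⁻¹ = a'`, with the derivative bounded on the compact closed ball).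
[folklore] -/
theorem exists_ball_bounds :
    ∃ r lam C : ℝ, 0 < r ∧ 0 < lam ∧ 0 ≤ C ∧
      closedBall (c.chart p hp.le p) r ⊆ (c.chart p hp.le).target ∧
      (∀ z ∈ ball (c.chart p hp.le p) r, fderiv ℝ (c.G ∘ (c.chart p hp.le).symm) z e₀ ≤ -lam) ∧
      (∀ z ∈ ball (c.chart p hp.le p) r, 0 ≤ z 0 →
        |c.G ((c.chart p hp.le).symm z) - c.a' + z 0| ≤ C * z 0) := by
  set Θ := c.chart p hp.le with hΘ
  set z₀ := Θ p with hz₀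
  set Gc := c.G ∘ Θ.symm with hGc
  have hz₀t : z₀ ∈ Θ.target := Θ.map_source (c.mem_chart_source p hp.le)
  have hz₀0 : z₀ 0 = 0 := c.chart_self_zero p hp
  -- a closed ball inside the target
  obtain ⟨r₁, hr₁, hball₁⟩ : ∃ r₁ > 0, closedBall z₀ r₁ ⊆ Θ.target := by
    obtain ⟨r', hr', h⟩ := Metric.isOpen_iff.1 Θ.open_target z₀ hz₀t
    exact ⟨r' / 2, by positivity, (closedBall_subset_ball (by linarith)).trans h⟩
  -- continuity of the derivative
  have hcont : ContinuousOn (fderiv ℝ Gc) Θ.target :=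
    (c.contDiffOn_G_chart_symm p hp.le).continuousOn_fderiv_of_isOpen Θ.open_target (by simp)
  -- the normal derivative near `z₀`
  obtain ⟨lam, hlam, hderiv⟩ := c.exists_fderiv_G_chart_symm_eq p hp
  have hval₀ : fderiv ℝ Gc z₀ e₀ = -lam := by
    show fderiv ℝ (c.G ∘ (c.chart p hp.le).symm) (c.chart p hp.le p) e₀ = -lam
    rw [hderiv, FunLike.coe_smul, Pi.smul_apply, smul_eq_mul]
    simp
  have hcont₀ : ContinuousAt (fun z => fderiv ℝ Gc z e₀) z₀ :=
    (hcont.continuousAt (Θ.open_target.mem_nhds hz₀t)).clm_apply continuousAt_const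
  obtain ⟨r₂, hr₂, hball₂⟩ : ∃ r₂ > 0, ∀ z ∈ ball z₀ r₂, fderiv ℝ Gc z e₀ < -lam / 2 := by
    have hev : ∀ᶠ z in 𝓝 z₀, fderiv ℝ Gc z e₀ < -lam / 2 :=
      hcont₀.eventually_lt continuousAt_const (by rw [hval₀]; linarith)
    exact Metric.eventually_nhds_iff_ball.1 hev
  -- a bound for the derivative on the closed ball
  obtain ⟨K, hK⟩ : ∃ K, ∀ z ∈ closedBall z₀ r₁, ‖fderiv ℝ Gc z‖ ≤ K :=
    (isCompact_closedBall z₀ r₁).exists_bound_of_continuousOn (hcont.mono hball₁)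
  refine ⟨min r₁ r₂, lam / 2, max K 0 + 1, lt_min hr₁ hr₂, by linarith, by positivity,
    (closedBall_subset_closedBall (min_le_left _ _)).trans hball₁,
    fun z hz => by have := hball₂ z (ball_subset_ball (min_le_right _ _) hz); linarith, fun z hz hz0 => ?_⟩
  -- the Hadamard bound
  have hzr₁ : z ∈ ball z₀ r₁ := ball_subset_ball (min_le_left _ _) hz
  set zh : 𝔼 (k + 1) := z - (z 0) • e₀ with hzh
  have hzh0 : zh 0 = 0 := by
    rw [hzh, PiLp.sub_apply, PiLp.smul_apply, e₀_apply_zero, smul_eq_mul, mul_one, sub_self]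
  have hnorm : ‖zh - z₀‖ ≤ ‖z - z₀‖ := by
    set v : 𝔼 (k + 1) := z - z₀ with hv
    have hv0 : v 0 = z 0 := by rw [hv, PiLp.sub_apply, hz₀0, sub_zero]
    have hzhv : zh - z₀ = v - (v 0) • e₀ := by rw [hv0, hzh, hv]; abel
    have horth : inner ℝ (v - (v 0) • e₀) ((v 0) • (e₀ : 𝔼 (k + 1))) = 0 := by
      rw [inner_smul_right, EuclideanSpace.inner_single_right]
      simp [PiLp.sub_apply, PiLp.smul_apply]
    have hpyth := norm_add_sq_eq_norm_sq_add_norm_sq_of_inner_eq_zero (v - (v 0) • e₀) ((v 0) • (e₀ : 𝔼 (k + 1))) horth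
    rw [sub_add_cancel] at hpyth
    rw [hzhv]
    nlinarith [norm_nonneg (v - (v 0) • (e₀ : 𝔼 (k + 1))), norm_nonneg v, norm_nonneg ((v 0) • (e₀ : 𝔼 (k + 1)))]
  have hzh_ball : zh ∈ ball z₀ r₁ := by
    rw [mem_ball, dist_eq_norm] at hzr₁ ⊢
    exact lt_of_le_of_lt hnorm hzr₁
  have hzh_t : zh ∈ Θ.target := hball₁ (ball_subset_closedBall hzh_ball)
  have hGzh : Gc zh = c.a' := c.G_chart_symm_of_zero p hp hzh_t hzh0
  have hmvt : ‖Gc z - Gc zh‖ ≤ K * ‖z - zh‖ :=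
    (convex_ball z₀ r₁).norm_image_sub_le_of_norm_fderiv_le
      (fun w hw => (c.contDiffAt_G_chart_symm p hp.le (hball₁ (ball_subset_closedBall hw))).differentiableAt
        (by simp))
      (fun w hw => hK w (ball_subset_closedBall hw)) hzh_ball hzr₁
  have hdiff : z - zh = (z 0) • (e₀ : 𝔼 (k + 1)) := by rw [hzh]; abel
  rw [hdiff, norm_smul, PiLp.norm_single, norm_one, mul_one, hGzh, Real.norm_eq_abs, Real.norm_eq_abs,
    abs_of_nonneg hz0] at hmvt
  have hK0 : K ≤ max K 0 := le_max_left K 0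
  calc |c.G ((c.chart p hp.le).symm z) - c.a' + z 0|
      ≤ |Gc z - c.a'| + |z 0| := abs_add_le _ _
    _ ≤ K * z 0 + z 0 := by rw [abs_of_nonneg hz0]; linarith
    _ ≤ (max K 0 + 1) * z 0 := by nlinarith

end Deriv

end LevelComparison

end Literature.Topology.FourManifolds

end
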